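import Literature.Computability.Complexity.AdaptiveProgramsGrowth
import Literature.Computability.Complexity.StackBricksArith
import Literature.Computability.Complexity.PlumbingBricks
import Literature.Computability.QuantumComplexity.Factoring

/-!
# Crux `ArithStatLadder.IqThreeNotPPoly` (stmt-QuantumAdvantage-2422), line `Sketch` — the apex sits ABOVE factoring, I:
# the least prime factor by binary search over the oracle `FACT`

Continuation lead `prover-line-stmt-QuantumAdvantage-2422-c4-0`. First of two files showing that the
squarefree apexes of the lines for cruxes 2422 / 14864 (`SQF ∉ P/poly`, `SQF ∉ BPP`) IMPLY the theses of
the factoring routes (`CircuitLB.ClbFactNotPpoly : FACT ∉ P/poly`, `Shor.ShorThesis : FACT ∉ BPP`):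
squarefreeness testing is a polynomial-time ADAPTIVE (Turing) reduction to the decision version of
factoring `FACT = {⟨N, k⟩ | ∃ d, 1 < d ≤ k, d ∣ N}`, written in the tree's relativised brick algebra
`AdQuery.AdPres` (`AdaptivePrograms.lean`), so that both `P^{P/poly} ⊆ P/poly` and `P^{BPP} = BPP` apply.

This file: the inner subroutine **`N ↦ minFac N` for `N ≥ 2` with `|bin N| + 1` oracle questions**
(`exists_minFac_adPres`): binary search for the least `k` with `⟨N, k⟩ ∈ FACT` (that `k` is
`Nat.minFac N`, `mem_factSet_iff_minFac_le`), as `|bin N| + 1` clocked rounds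
(`AdPres.iterate_of_growth`) of one presented round `⟨bin N, ⟨bin lo, bin hi⟩⟩ ↦ ⟨bin N, ⟨bin lo', bin hi'⟩⟩`
(`mid = (lo + hi)/2`; ask `⟨N, mid⟩`; keep the half containing `minFac N`; the second component is
clipped to `5|bin N| + 4` symbols so that the round has linear growth on EVERY word). The arithmetic of
the search is the oracle-free lemma `binarySearch_invariant` (invariant `1 ≤ lo < minFac N ≤ hi ≤ N`,
gap `(hi − lo − 1)·2^k ≤ N − 2` after `k` rounds).
-/

set_option linter.dupNamespace false -- D-0017: single-problem summit ⇒ `QuantumAdvantage.QuantumAdvantage` by design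

noncomputable section

namespace Summit.QuantumAdvantage.QuantumAdvantage.Theorems.IqThreeNotPPoly

open _root_.Computability Polynomial Literature.Computability.Complexity
open Literature.Computability.Complexity.Brick Literature.Computability.Complexity.Plumb
open Literature.Computability.Complexity.AdQuery
open Literature.Computability.QuantumComplexity (FACT factSet mem_factSet_iff_minFac_le)

/-! ### The arithmetic of the binary search (oracle-free) -/

/-- **Binary search invariant.** If `F` performs one round
`⟨x, ⟨bin lo, bin hi⟩⟩ ↦ ⟨x, ⟨bin lo', bin hi'⟩⟩` of the search for `minFac N` on every state with
`1 ≤ lo < hi ≤ N`, then after `k` rounds from `⟨x, ⟨bin 1, bin N⟩⟩` the state is such a pair with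
`1 ≤ lo < minFac N ≤ hi ≤ N` and `(hi − lo − 1)·2^k ≤ N − 2`. [folklore] -/
theorem binarySearch_invariant (F : List Bool → List Bool) (x : List Bool) {N : ℕ} (hN : 2 ≤ N)
    (hstep : ∀ lo hi : ℕ, 1 ≤ lo → lo < hi → hi ≤ N →
      F (boolPair x (boolPair (encodeNat lo) (encodeNat hi))) =
        boolPair x (boolPair
          (encodeNat (if lo + 1 < hi then (if N.minFac ≤ (lo + hi) / 2 then lo else (lo + hi) / 2) else lo))
          (encodeNat (if lo + 1 < hi then (if N.minFac ≤ (lo + hi) / 2 then (lo + hi) / 2 else hi) else hi))))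
    (k : ℕ) : ∃ lo hi : ℕ,
      F^[k] (boolPair x (boolPair (encodeNat 1) (encodeNat N))) =
        boolPair x (boolPair (encodeNat lo) (encodeNat hi)) ∧
      1 ≤ lo ∧ lo < N.minFac ∧ N.minFac ≤ hi ∧ hi ≤ N ∧ (hi - lo - 1) * 2 ^ k ≤ N - 2 := by
  have hmf2 : 2 ≤ N.minFac := (Nat.minFac_prime (by omega)).two_le
  have hmfN : N.minFac ≤ N := Nat.minFac_le (by omega)
  induction k with
  | zero => exact ⟨1, N, rfl, le_rfl, by omega, hmfN, le_rfl, by rw [pow_zero, mul_one]; omega⟩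
  | succ k ih =>
    obtain ⟨lo, hi, hk, h1, hlo, hhi, hN', hgap⟩ := ih
    rw [Function.iterate_succ_apply', hk, hstep lo hi h1 (by omega) hN']
    by_cases hg : lo + 1 < hi
    · rw [if_pos hg, if_pos hg]
      by_cases hm : N.minFac ≤ (lo + hi) / 2
      · rw [if_pos hm, if_pos hm]
        refine ⟨lo, (lo + hi) / 2, rfl, h1, hlo, hm, by omega, ?_⟩
        have h2 : ((lo + hi) / 2 - lo - 1) * 2 ≤ hi - lo - 1 := by omega
        calc ((lo + hi) / 2 - lo - 1) * 2 ^ (k + 1) = ((lo + hi) / 2 - lo - 1) * 2 * 2 ^ k := by ring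
          _ ≤ (hi - lo - 1) * 2 ^ k := Nat.mul_le_mul_right _ h2
          _ ≤ N - 2 := hgap
      · rw [if_neg hm, if_neg hm]
        refine ⟨(lo + hi) / 2, hi, rfl, by omega, by omega, hhi, hN', ?_⟩
        have h2 : (hi - (lo + hi) / 2 - 1) * 2 ≤ hi - lo - 1 := by omega
        calc (hi - (lo + hi) / 2 - 1) * 2 ^ (k + 1) = (hi - (lo + hi) / 2 - 1) * 2 * 2 ^ k := by ring
          _ ≤ (hi - lo - 1) * 2 ^ k := Nat.mul_le_mul_right _ h2
          _ ≤ N - 2 := hgap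
    · rw [if_neg hg, if_neg hg]
      exact ⟨lo, hi, rfl, h1, hlo, hhi, hN', by
        have : hi - lo - 1 = 0 := by omega
        rw [this, zero_mul]; exact Nat.zero_le _⟩

/-- After `|bin N| + 1` rounds the gap is closed: `hi = lo + 1`, so `hi = minFac N`. [folklore] -/
theorem binarySearch_final {N lo hi : ℕ} (hlo : lo < N.minFac) (hhi : N.minFac ≤ hi)
    (hgap : (hi - lo - 1) * 2 ^ ((encodeNat N).length + 1) ≤ N - 2) : hi = N.minFac := by
  have hlt : N < 2 ^ (encodeNat N).length := by
    have h := bitsToNat_lt (encodeNat N); rwa [bitsToNat_encodeNat] at h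
  have h0 : hi - lo - 1 = 0 := by
    by_contra h
    have h1 : 1 ≤ hi - lo - 1 := Nat.one_le_iff_ne_zero.2 h
    have h2 := Nat.mul_le_mul_right (2 ^ ((encodeNat N).length + 1)) h1
    rw [one_mul] at h2
    have h3 : 2 ^ (encodeNat N).length < 2 ^ ((encodeNat N).length + 1) :=
      Nat.pow_lt_pow_right (by norm_num) (by omega)
    omega
  omega

/-! ### The oracle answer -/

/-- The oracle bit on the canonical pair `⟨bin N, bin k⟩` is `[minFac N ≤ k]` (`N ≠ 1`). [folklore] -/
theorem boolIndicator_FACT_pair {N : ℕ} (hN : N ≠ 1) (k : ℕ) :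
    FACT.boolIndicator (boolPair (encodeNat N) (encodeNat k)) = decide (N.minFac ≤ k) := by
  have hiff : boolPair (encodeNat N) (encodeNat k) ∈ FACT ↔ N.minFac ≤ k := by
    rw [← mem_factSet_iff_minFac_le hN k]
    exact (encodingNatBool.pairBool encodingNatBool).mem_toLanguage_iff factSet (N, k)
  by_cases h : N.minFac ≤ k
  · rw [decide_eq_true h]; exact (Set.mem_iff_boolIndicator _ _).1 (hiff.2 h)
  · rw [decide_eq_false h]; exact (Set.notMem_iff_boolIndicator _ _).1 (fun h' => h (hiff.1 h'))

/-! ### The presented subroutine `bin N ↦ bin (minFac N)` -/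

/-- **`minFac` is computable with a `FACT` oracle, as a presented adaptive program**: some `mf` with
`AdPres FACT mf` satisfies `mf (bin N) = bin (minFac N)` for every `N ≥ 2`. Program: initialise
`⟨bin N, ⟨bin 1, bin N⟩⟩`, run `|bin N| + 1` clocked rounds of the presented binary-search round
(one `FACT` query `⟨N, mid⟩` each, second component clipped to `5|bin N| + 4` symbols for linear
growth), output the `hi` component. [folklore] -/
theorem exists_minFac_adPres : ∃ mf : List Bool → List Bool, AdPres FACT mf ∧
    ∀ N : ℕ, 2 ≤ N → mf (encodeNat N) = encodeNat N.minFac := by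
  -- projections and arithmetic of one round, as `FP` bricks on the state `w = ⟨x', ⟨lo, hi⟩⟩`
  let LO : List Bool → List Bool := fstF ∘ sndF
  let HI : List Bool → List Bool := sndF ∘ sndF
  let MID : List Bool → List Bool := divFn ∘ fanoutFn (addFn ∘ fanoutFn LO HI) (fun _ => encodeNat 2)
  let GUARD : List Bool → List Bool :=
    ltFn ∘ fanoutFn (addFn ∘ fanoutFn LO (fun _ => encodeNat 1)) HI
  let QRY : List Bool → List Bool := fun w => [FACT.boolIndicator (fanoutFn fstF MID w)]
  let BODY : List Bool → List Bool :=
    iteFn GUARD (iteFn QRY (fanoutFn LO MID) (fanoutFn MID HI)) (fanoutFn LO HI)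
  let CLIP : List Bool → List Bool := takeFn ∘ fanoutFn (polyFn (5 * X + 4) ∘ fstF) BODY
  let G : List Bool → List Bool := fanoutFn fstF CLIP
  have hLO : LO ∈ FP := comp_mem_FP fstF_mem_FP sndF_mem_FP
  have hHI : HI ∈ FP := comp_mem_FP sndF_mem_FP sndF_mem_FP
  have hMID : MID ∈ FP := comp_mem_FP divFn_mem_FP
    (fanoutFn_mem_FP (comp_mem_FP addFn_mem_FP (fanoutFn_mem_FP hLO hHI)) (const_mem_FP _))
  have hGUARD : GUARD ∈ FP := comp_mem_FP ltFn_mem_FP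
    (fanoutFn_mem_FP (comp_mem_FP addFn_mem_FP (fanoutFn_mem_FP hLO (const_mem_FP _))) hHI)
  have hQRY : AdPres FACT QRY := AdPres.query (fanoutFn_mem_FP fstF_mem_FP hMID)
  have hBODY : AdPres FACT BODY :=
    AdPres.ite (AdPres.of_mem_FP hGUARD)
      (AdPres.ite hQRY (AdPres.of_mem_FP (fanoutFn_mem_FP hLO hMID))
        (AdPres.of_mem_FP (fanoutFn_mem_FP hMID hHI)))
      (AdPres.of_mem_FP (fanoutFn_mem_FP hLO hHI))
  have hCLIP : AdPres FACT CLIP :=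
    AdPres.FP_comp (AdPres.fanout (AdPres.of_mem_FP (comp_mem_FP (polyFn_mem_FP _) fstF_mem_FP)) hBODY)
      takeFn_mem_FP
  have hG : AdPres FACT G := AdPres.fanout (AdPres.of_mem_FP fstF_mem_FP) hCLIP
  -- growth and first-field preservation on EVERY word
  have hfst : ∀ w, fstF (G w) = fstF w := fun w => by simp [G]
  have hgrowth : ∀ w, (G w).length ≤ w.length + 7 * ((fstF w).length + 1) := by
    intro w
    have hclip : (CLIP w).length ≤ 5 * (fstF w).length + 4 := by
      simp only [CLIP, Function.comp_apply, fanoutFn_apply, takeFn_boolPair, polyFn_apply,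
        List.length_take, List.length_replicate, eval_add, eval_mul, eval_ofNat, eval_X]
      exact min_le_left _ _
    simp only [G, fanoutFn_apply, length_boolPair]
    nlinarith [hclip]
  -- the value of one round on a well-formed state
  have hround : ∀ N : ℕ, 2 ≤ N → ∀ lo hi : ℕ, 1 ≤ lo → lo < hi → hi ≤ N →
      G (boolPair (encodeNat N) (boolPair (encodeNat lo) (encodeNat hi))) =
        boolPair (encodeNat N) (boolPair
          (encodeNat (if lo + 1 < hi then (if N.minFac ≤ (lo + hi) / 2 then lo else (lo + hi) / 2) else lo))
          (encodeNat (if lo + 1 < hi then (if N.minFac ≤ (lo + hi) / 2 then (lo + hi) / 2 else hi)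
            else hi))) := by
    intro N hN lo hi h1 hlh hhN
    set w := boolPair (encodeNat N) (boolPair (encodeNat lo) (encodeNat hi)) with hw
    have vLO : LO w = encodeNat lo := by simp [LO, hw]
    have vHI : HI w = encodeNat hi := by simp [HI, hw]
    have vMID : MID w = encodeNat ((lo + hi) / 2) := by
      simp [MID, fanoutFn_apply, vLO, vHI]
    have vGUARD : GUARD w = [decide (lo + 1 < hi)] := by
      simp [GUARD, fanoutFn_apply, vLO, vHI]
    have vQRY : QRY w = [decide (N.minFac ≤ (lo + hi) / 2)] := by
      show [FACT.boolIndicator (fanoutFn fstF MID w)] = _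
      have hf : fstF w = encodeNat N := by rw [hw, fstF_boolPair]
      rw [fanoutFn_apply, vMID, hf, boolIndicator_FACT_pair (show N ≠ 1 by omega)]
    -- the body, before clipping
    have vBODY : BODY w = boolPair
        (encodeNat (if lo + 1 < hi then (if N.minFac ≤ (lo + hi) / 2 then lo else (lo + hi) / 2) else lo))
        (encodeNat (if lo + 1 < hi then (if N.minFac ≤ (lo + hi) / 2 then (lo + hi) / 2 else hi)
          else hi)) := by
      by_cases hg : lo + 1 < hi
      · simp only [BODY, if_pos hg]
        rw [iteFn_apply_true (by rw [vGUARD, decide_eq_true hg])]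
        by_cases hm : N.minFac ≤ (lo + hi) / 2
        · rw [iteFn_apply_true (by rw [vQRY, decide_eq_true hm]), if_pos hm, if_pos hm,
            fanoutFn_apply, vLO, vMID]
        · rw [iteFn_apply_false (by rw [vQRY, decide_eq_false hm]), if_neg hm, if_neg hm,
            fanoutFn_apply, vMID, vHI]
      · simp only [BODY, if_neg hg]
        rw [iteFn_apply_false (by rw [vGUARD, decide_eq_false hg]), fanoutFn_apply, vLO, vHI]
    -- clipping is a no-op: both numerals are `≤ N`, hence no longer than `bin N`
    have hlen : (BODY w).length ≤ 5 * (encodeNat N).length + 4 := by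
      rw [vBODY, length_boolPair]
      have ha : (encodeNat (if lo + 1 < hi then (if N.minFac ≤ (lo + hi) / 2 then lo else (lo + hi) / 2)
          else lo)).length ≤ (encodeNat N).length :=
        length_encodeNat_mono (by split_ifs <;> omega)
      have hb : (encodeNat (if lo + 1 < hi then (if N.minFac ≤ (lo + hi) / 2 then (lo + hi) / 2 else hi)
          else hi)).length ≤ (encodeNat N).length :=
        length_encodeNat_mono (by split_ifs <;> omega)
      omega
    have vCLIP : CLIP w = BODY w := by
      simp only [CLIP, Function.comp_apply, fanoutFn_apply, takeFn_boolPair, polyFn_apply,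
        List.length_replicate, eval_add, eval_mul, eval_ofNat, eval_X, hw, fstF_boolPair]
      rw [← hw]
      exact List.take_of_length_le hlen
    simp only [G, fanoutFn_apply, hw, fstF_boolPair]
    rw [← hw, vCLIP, vBODY]
  -- the clocked iteration, initialisation and output
  have hITER : AdPres FACT (fun z => G^[(X + 1 : Polynomial ℕ).eval (fstF z).length] z) :=
    AdPres.iterate_of_growth hG 7 hfst hgrowth (X + 1)
  let INIT : List Bool → List Bool := fanoutFn (fun w => w) (fanoutFn (fun _ => encodeNat 1) (fun w => w))
  have hINIT : INIT ∈ FP :=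
    fanoutFn_mem_FP (PolyTimeComputable.id _) (fanoutFn_mem_FP (const_mem_FP _) (PolyTimeComputable.id _))
  refine ⟨HI ∘ (fun z => G^[(X + 1 : Polynomial ℕ).eval (fstF z).length] z) ∘ INIT,
    AdPres.FP_comp (AdPres.comp_FP hITER hINIT) hHI, fun N hN => ?_⟩
  have hstart : INIT (encodeNat N) = boolPair (encodeNat N) (boolPair (encodeNat 1) (encodeNat N)) := by
    simp [INIT]
  simp only [Function.comp_apply, hstart, fstF_boolPair, eval_add, eval_X, eval_one]
  obtain ⟨lo, hi, hk, -, hlo, hhi, -, hgap⟩ :=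
    binarySearch_invariant G (encodeNat N) hN (hround N hN) ((encodeNat N).length + 1)
  rw [hk]
  simp only [HI, Function.comp_apply, sndF_boolPair]
  rw [binarySearch_final hlo hhi hgap]

end Summit.QuantumAdvantage.QuantumAdvantage.Theorems.IqThreeNotPPoly

end
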